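import Summits.QuantumFields.YangMills.Theorems.AlphaInputsT3ACv3StartCert
import Summits.QuantumFields.YangMills.Theorems.AlphaInputsT3ACv3StartTwoCellSat
import Summits.QuantumFields.YangMills.Theorems.AlphaInputsT3ACv3StartOmegaSat
import Summits.QuantumFields.YangMills.Theorems.AlphaInputsT3ACv3HLiftWindowRows
import Summits.QuantumFields.YangMills.Theorems.AlphaInputsT3ACv3NewtonLiftStencilRowsTgt
import Summits.QuantumFields.YangMills.Theorems.AlphaInputsT3ACv3NewtonLiftRegionalKFree
import Summits.QuantumFields.YangMills.Theorems.AlphaInputsT3ACv3NewtonLiftOneBlockCert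
import Summits.QuantumFields.YangMills.Theorems.AlphaInputsT3ACv3StartPlaqChart
import HarnessLib

/-!
# `AlphaInputsT3ACv3HLiftClauseOfStart` — MAP #3 M22: **THE `hLift` CLAUSE FOR `16 ≤ L^k` = START ∘ KERNEL CERTIFICATE ∘ REGIONAL NEWTON LIFT, THE SKELETON (v1)** — for one `(k, h, V)`,
# `Ω := Ω_{k+1}(h)`, `C := bondsIn k Ω`, `Pl := plaqsIn 0 Ω`, datum `V` windowed by `ε′` on `plaqsIn k Ω`, `0 < ε′ ≤ 1∕(10³⁴·L)`, `|n| = 2`: an EXACT `k`-fold lift `U` of `V` on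
# `bondsIn k Ω` with `dist1 U(∂q) ≤ 10²⁷·ε′∕L^{2k}` on `plaqsIn 0 Ω` — ★w4 g2's (H) `exists_exact_lift_regional_window_kfree` instantiated BY `exact` at the START field
# `U₀ := startT3 F K k Ω V (tubeBd ε′)` (LEAD's ★★★`startT3_cert`: (P) `δ₀ := startBd`, (D) `η₀`), the stencil gauges `σ_c := axialT U₀ (toFine k c₋)` with stencils the two
# `k`-blocks (★w4 g2 `norm_gaugeAct_centreAxial_sub_one_le`: `x := L^k·(D·δ₀)`), the kernel of record `R₀` of (I) `exists_obLift_gaugeKernel` ((α)(β), (γ) with `hosc` by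
# ★`osc_centreAxial_of_twoCell`, (δ)), the plaquette gauges `g_q := σ_{⟨blk q₋, q.μ⟩}`, the numeral rows (K1)–(K7)∕(S6)∕scales by ✓`window_Krows`∕`window_S6rows`∕`window_scales`,
# `htwo` by LEAD's `htwo_of_sat (omega_sat)`, and the plaquette-gauge flatness (H)'s `hU₀P` ∕ the certificate's (δ) by THIS seat's plaquette chart
# `norm_gaugeAct_axialT_sub_one_le_of_plaqsIn` (2×2 corner case included).  DISPLAYED (v1): ONLY the START lattice rows `hbox hsep hcov hbox_sh hsep_sh hcov_sh` VERBATIM as in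
# `startT3_cert` (v2 consumes LEAD's `startT3_cert_omega` + ★w5's `hsep_canon`∕`hsep_shell` and displays none) — lane `pub-balaban3d` ∕ cell `ym3-torus`, seat `ym-ust-19936-w4` (g3)

WHY (cell `ym3-torus` 2026-08-28: ★★OWNER g25 (J) 03:44:03Z ∕ g26 04:43:05Z «★w4-19936 g3 CLAIM M22 `…HLiftClauseOfStart` (`hLift_clause_of_start`) ACK∕GO»; LEAD ★w1 g2 04:20Z∕04:36Z;
★w2 g3 04:51:45Z consumes the concluding shape in the final window knit `hLift_window_of_clauses` (small k = ✓`hLift_small`)).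
HONEST FRAMING.  Composition by `exact` of landed theorems; the displayed rows are hypotheses, never asserted; `hLift` as a whole, the stub 2′χ `stub_laneRecordsV3Chi`, the crux
`HistoryTailL` and any gap are NOT claimed; count-neutral helper toward R3 2′ (items 19936∕19935); registry untouched; nothing about d = 4, the continuum, or a mass gap; YM₃ on T³
is rung R3 of the YM ladder, not the Clay problem.

References: T. Bałaban, Commun. Math. Phys. 102 (1985) 277–309 [Balaban1985Variational] (Thm 1 (8) p.279, (11)–(15) pp.279–280); CMP 98 (1985) 17–51 [Balaban1985Averaging]
(Props. 4–5 pp.38–42, (8)–(13) pp.18–19); CMP 109 (1987) 249–301 [Balaban1987RG1] ((0.4), (0.11) p.253).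
-/

set_option autoImplicit false

noncomputable section

open scoped Matrix.Norms.L2Operator

namespace Summit.QuantumFields.YangMills.Theorems.TubeStart

open Literature.MathematicalPhysics.QuantumFieldTheory.Balaban1983to89
open T4Continuum BlockAveraging ExpMeanLog
open Literature.MathematicalPhysics.QuantumFieldTheory.Balaban1983to89.T4AdjointCovarianceUnitary (lieSU expSU)
open Literature.MathematicalPhysics.QuantumFieldTheory.Balaban1983to89.BlockAveragingSectionAction (iterSec)
open Literature.MathematicalPhysics.QuantumFieldTheory.Balaban1983to89.B5Eq118OneStroke (iterBlockOf)
open Literature.MathematicalPhysics.QuantumFieldTheory.Balaban1983to89.B10Eq38TorusDomains (toFine plaqsIn)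
open Literature.MathematicalPhysics.QuantumFieldTheory.Balaban1983to89.B10Eq42TorusConstraint (bondsIn)
open Literature.MathematicalPhysics.QuantumFieldTheory.Balaban1983to89.B10Eq27TorusAxialLog (axialT)
open Literature.MathematicalPhysics.QuantumFieldTheory.Balaban1983to89.T3ContinuumYM3Torus (T3Family)
open Summit.QuantumFields.Balaban3D.Carriers
open Summit.QuantumFields.YangMills.Theorems.ModelBox
open Summit.QuantumFields.YangMills.Theorems.StartDefectBox (twoCellSet)
open Summit.QuantumFields.YangMills.Theorems.AvgIterLocality (coarsen_eq_iterBlockOf)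
open Summit.QuantumFields.YangMills.Theorems.LinearLiftMatrix (linAvgIterM curlM)
open Summit.QuantumFields.YangMills.Theorems.NewtonLiftFramed (exists_exact_lift_regional_window_kfree exists_obLift_gaugeKernel norm_gaugeAct_centreAxial_sub_one_le
  osc_centreAxial_of_twoCell)

variable (F : T3Family) (K : ℕ) (M₁ : ℕ) (Rcol : ℕ → ℕ) {n : Type*} [Fintype n] [DecidableEq n] [Nonempty n]

/-- `3 ≤ L` for the family (`L` odd and `> 1`). [folklore] -/
theorem three_le_PL : 3 ≤ (F.P K).L := by
  show 3 ≤ F.L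
  obtain ⟨⟨j, hj⟩, h1⟩ := F.hL
  omega

open Classical in
/-- **★★★ THE NEWTON HALF OF THE `hLift` CLAUSE (M22 CORE): ANY APPROXIMATE START WITH ROWS (P) AND (D) IS CORRECTED TO AN EXACT LIFT.**  `k ≤ K`, `16 ≤ L^k`, `4L^k ≤ sitesPerDir 0`,
`|n| = 2`, `0 < ε′ ≤ 1∕(10³⁴·L)`, a plaquette number `0 ≤ δ₀ ≤ 83559424·ε′∕(L^k)²`, and ANY finest field `U₀` with (P) `dist1 U₀(∂q) ≤ δ₀` on `plaqsIn 0 Ω_{k+1}(h)` and (D)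
`‖Ū₀^{(k)}(c)·V(c)* − 1‖ ≤ 2(d+1)L^k·(D·δ₀)` on `bondsIn k Ω_{k+1}(h)` (`D = d⌊L^k∕2⌋ + L^k`).  THEN some finest `U` has exact `k`-fold `expMeanLogSU`-block averages `V` on
`bondsIn k Ω_{k+1}(h)` and `dist1 U(∂q) ≤ 10²⁷·(ε′∕(L^k)²)` on `plaqsIn 0 Ω_{k+1}(h)` — (H) `exists_exact_lift_regional_window_kfree` at the centre-anchored comb gauges
`σ_c := axialT U₀ (toFine k c₋)` (stencil rows ★w4 g2 §1, `hosc` ★`osc_centreAxial_of_twoCell`), the kernel of record (I) `exists_obLift_gaugeKernel`, the plaquette gauges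
`g_q := σ_{⟨blk q₋, q.μ⟩}` with the plaquette chart `norm_gaugeAct_axialT_sub_one_le_of_plaqsIn`, saturation `omega_sat`∕`htwo_of_sat`, and the window's numeral rows
`window_Krows`∕`window_scales`. [cite: Balaban1985Variational, Thm 1 (8) p.279, (11)–(15) pp.279–280; Balaban1985Averaging, Props. 4–5 pp.38–42] -/
theorem hLift_clause_of_PD (hn2 : Fintype.card n = 2) {k : ℕ} (hkK : k ≤ K) (hm : 16 ≤ (F.P K).L ^ k) (hN4 : 4 * (F.P K).L ^ k ≤ (F.P K).sitesPerDir 0)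
    (h : Hist (F.P K) (k + 1)) (V : GaugeField (F.P K) k (Matrix.specialUnitaryGroup n ℂ)) {ε' : ℝ} (hε : 0 < ε') (hεFL : ε' ≤ 1 / (10 ^ 34 * (F.L : ℝ)))
    (U₀ : GaugeField (F.P K) 0 (Matrix.specialUnitaryGroup n ℂ)) {δ₀ : ℝ} (hδ₀0 : 0 ≤ δ₀) (hδ₀B : δ₀ ≤ 83559424 * ε' / (((F.P K).L ^ k : ℕ) : ℝ) ^ 2)
    (hP : ∀ q : Plaq (F.P K) 0, q ∈ plaqsIn 0 (Omega M₁ Rcol (k + 1) h (k + 1)) → GaugeGroup.dist1 (GaugeField.plaqHol U₀ q) ≤ δ₀)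
    (hD : ∀ c : PBond (F.P K) k, c ∈ bondsIn k (Omega M₁ Rcol (k + 1) h (k + 1)) →
      ‖((Averaging.iter (fun i => (blockAvg (expMeanLogSU (n := n)) : Averaging (F.P K) i (Matrix.specialUnitaryGroup n ℂ))) k U₀ c :
          Matrix.specialUnitaryGroup n ℂ) : Matrix n n ℂ) * star ((V c : Matrix.specialUnitaryGroup n ℂ) : Matrix n n ℂ) - 1‖ ≤
        2 * ((((F.P K).d : ℝ) + 1) * ((F.P K).L : ℝ) ^ k * (((((F.P K).d * ((F.P K).L ^ k / 2) + (F.P K).L ^ k : ℕ)) : ℝ) * δ₀))) :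
    ∃ U : GaugeField (F.P K) 0 (Matrix.specialUnitaryGroup n ℂ),
      (∀ b : PBond (F.P K) k, b ∈ bondsIn k (Omega M₁ Rcol (k + 1) h (k + 1)) →
        Averaging.iter (fun i => (blockAvg (expMeanLogSU (n := n)) : Averaging (F.P K) i (Matrix.specialUnitaryGroup n ℂ))) k U b = V b) ∧
      ∀ q : Plaq (F.P K) 0, q ∈ plaqsIn 0 (Omega M₁ Rcol (k + 1) h (k + 1)) →
        GaugeGroup.dist1 (GaugeField.plaqHol U q) ≤ 10 ^ 27 * (ε' / (((F.P K).L : ℝ) ^ k) ^ 2) := by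
  -- the letters
  set Ω : Set (Site (F.P K) 0) := Omega M₁ Rcol (k + 1) h (k + 1) with hΩ
  set Lk : ℝ := ((F.P K).L : ℝ) ^ k with hLk
  set Dn : ℕ := (F.P K).d * ((F.P K).L ^ k / 2) + (F.P K).L ^ k with hDn
  set D2n : ℕ := (F.P K).d * ((F.P K).L ^ k / 2) + 2 * (F.P K).L ^ k with hD2n
  set hn : ℕ := (F.P K).d * ((F.P K).L ^ k / 2) with hhn
  set x : ℝ := Lk * ((Dn : ℝ) * δ₀) with hxdef
  set η₀ : ℝ := 2 * ((((F.P K).d : ℝ) + 1) * Lk * ((Dn : ℝ) * δ₀)) with hη₀def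
  set ω : ℝ := ((Dn : ℝ) * δ₀ + (Dn : ℝ) * δ₀) * (hn : ℝ) with hωdef
  set κ : ℝ := ((((F.P K).d : ℝ) + 1) * Lk) * ((1056 / Lk) * (2 * ω)) with hκdef
  set t : ℝ := 84480 * (83559424 * ε') with htdef
  set ηp : ℝ := (D2n : ℝ) * δ₀ with hηpdef
  set Ccurl : ℝ := 1728 + 12672 * (ηp * Lk) with hCcurldef
  -- sizes
  have hPL : (F.P K).L = F.L := rfl
  have hL3 : 3 ≤ (F.P K).L := three_le_PL F K
  have hd3 : (F.P K).d = 3 := T3Family.P_d F K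
  have hd2 : 2 ≤ (F.P K).d := by rw [hd3]; norm_num
  have hk : k ≤ (F.P K).m + (F.P K).K := le_trans hkK (Nat.le_add_left _ _)
  have hn3 : 3 ≤ F.L ^ k := by rw [← hPL]; omega
  have hεFL' : ε' ≤ 1 / (10 ^ 34 * ((F.P K).L : ℝ)) := by rw [hPL]; exact hεFL
  have hL1 : (1 : ℝ) ≤ ((F.P K).L : ℝ) := by exact_mod_cast (F.P K).hL.2.le
  have hLk0 : 0 < Lk := by rw [hLk]; positivity
  obtain ⟨-, -, hε1, -, -⟩ := window_eps (F.P K) hL3 hε hεFL'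
  -- the numeral rows
  obtain ⟨ht0, ht4, hx0, hη₀0, hκ0, K1, K2, K3, K4, K5, K6, K7⟩ :=
    window_Krows (F.P K) k hd3 hL3 hn2 hε hεFL' hδ₀0 hδ₀B hxdef hη₀def hωdef hκdef htdef
  obtain ⟨hδ₀A, hη₀A, hηpA, hCcurl1, hBtot⟩ := window_scales (F.P K) k hd3 hL3 hε hεFL' hδ₀0 hδ₀B
  obtain ⟨-, -, -, -, hω0, -, -, -, -⟩ := window_letters (F.P K) k hd3 hδ₀0 hδ₀B hxdef hη₀def hωdef hκdef htdef
  have hηp0 : 0 ≤ ηp := by rw [hηpdef]; positivity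
  have hCcurl0 : 0 ≤ Ccurl := by rw [hCcurldef]; positivity
  -- saturation and the two-cell binder
  have hsat := omega_sat M₁ Rcol hk h
  have htwo := htwo_of_sat hk hsat
  -- the plaquette bound on the two-cell box of a constrained coarse bond
  have hUbox : ∀ c : PBond (F.P K) k, c ∈ bondsIn k Ω → ∀ q : Plaq (F.P K) 0, (∀ κ, q.src κ ∈ twoCellSet k c κ) →
      (∀ κ, ((q.src.shift q.μ).shift q.ν) κ ∈ twoCellSet k c κ) → GaugeGroup.dist1 (GaugeField.plaqHol U₀ q) ≤ δ₀ := fun c hc q h1 h2 => hP q (htwo c hc q h1 h2)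
  -- the plaquette chart (★w4 g3 `…StartPlaqChart`): the comb gauges of the three blocks are `D₂δ₀`-flat on the four bonds of a constrained plaquette
  have hflatP : ∀ q : Plaq (F.P K) 0, q ∈ plaqsIn 0 Ω →
      ∀ y : Site (F.P K) k, (y = iterBlockOf k q.src ∨ y = iterBlockOf k (q.src.shift q.μ) ∨ y = iterBlockOf k (q.src.shift q.ν)) →
      ∀ b : PBond (F.P K) 0, (b = ⟨q.src, q.μ⟩ ∨ b = ⟨q.src.shift q.μ, q.ν⟩ ∨ b = ⟨q.src.shift q.ν, q.μ⟩ ∨ b = ⟨q.src, q.ν⟩) →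
      ‖((GaugeField.gaugeAct (axialT U₀ (toFine k y)) U₀ b : Matrix.specialUnitaryGroup n ℂ) : Matrix n n ℂ) - 1‖ ≤ (D2n : ℝ) * δ₀ :=
    fun q hq y hy b hb => norm_gaugeAct_axialT_sub_one_le_of_plaqsIn hk hN4 hsat U₀ hδ₀0 hP q hq y hy b hb
  -- THE GAUGES, THE STENCILS, THE KERNEL
  let σ : PBond (F.P K) k → GaugeTransf (F.P K) 0 (Matrix.specialUnitaryGroup n ℂ) := fun c => axialT U₀ (toFine k c.src)
  let N : PBond (F.P K) k → Set (Site (F.P K) 0) := fun c => {z | iterBlockOf k z = c.src ∨ iterBlockOf k z = c.tgt}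
  obtain ⟨R₀, hα, hβ, hγ, hδ⟩ := exists_obLift_gaugeKernel (n := n) hkK hn3 σ
  let g : Plaq (F.P K) 0 → GaugeTransf (F.P K) 0 (Matrix.specialUnitaryGroup n ℂ) := fun q => σ ⟨iterBlockOf k q.src, q.μ⟩
  -- (H)'s rows
  have hxD : x / Lk = (Dn : ℝ) * δ₀ := by rw [hxdef]; field_simp
  have hU₀ : ∀ c ∈ bondsIn k Ω, ∀ b : PBond (F.P K) 0, b.src ∈ N c → b.tgt ∈ N c →
      ‖((GaugeField.gaugeAct (σ c) U₀ b : Matrix.specialUnitaryGroup n ℂ) : Matrix n n ℂ) - 1‖ ≤ x / ((F.P K).L : ℝ) ^ k := fun c hc b hs ht => by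
    rw [← hLk, hxD]
    exact norm_gaugeAct_centreAxial_sub_one_le hk hN4 U₀ c hδ₀0 (hUbox c hc) b hs ht
  have hRS : ∀ u : PBond (F.P K) k → Matrix n n ℂ, (∀ c, u c ∈ lieSU n) → (∀ c, c ∉ bondsIn k Ω → u c = 0) → ∀ b, R₀ u b ∈ lieSU n :=
    fun u hu _ b => hα u hu b
  have hRn : ∀ u : PBond (F.P K) k → Matrix n n ℂ, (∀ c, u c ∈ lieSU n) → (∀ c, c ∉ bondsIn k Ω → u c = 0) → ‖R₀ u‖ ≤ (1056 / ((F.P K).L : ℝ) ^ k) * ‖u‖ :=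
    fun u _ _ => hβ u
  have hRinv : ∀ u : PBond (F.P K) k → Matrix n n ℂ, (∀ c, u c ∈ lieSU n) → (∀ c, c ∉ bondsIn k Ω → u c = 0) → ∀ c ∈ bondsIn k Ω,
      ‖star (transfUp (σ c) k c.src : Matrix n n ℂ) * linAvgIterM k (fun b => ((σ c b.src : Matrix.specialUnitaryGroup n ℂ) : Matrix n n ℂ) * R₀ u b * star (σ c b.src : Matrix n n ℂ)) c *
          (transfUp (σ c) k c.src : Matrix n n ℂ) - u c‖ ≤ κ * ‖u‖ := by
    intro u _ _ c hc
    have hosc : ∀ b : PBond (F.P K) 0, (iterBlockOf k b.src = c.src ∨ iterBlockOf k b.src = c.tgt) → (iterBlockOf k b.tgt = c.src ∨ iterBlockOf k b.tgt = c.tgt) →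
        ∀ c' : PBond (F.P K) k, c'.src = coarsen k b.src →
          ‖((σ c b.src * (σ c' b.src)⁻¹ : Matrix.specialUnitaryGroup n ℂ) : Matrix n n ℂ) -
            ((transfUp (σ c) k c'.src * (transfUp (σ c') k c'.src)⁻¹ : Matrix.specialUnitaryGroup n ℂ) : Matrix n n ℂ)‖ ≤ ω := by
      intro b hb1 _ c' hc'
      rw [coarsen_eq_iterBlockOf] at hc'
      exact osc_centreAxial_of_twoCell hd2 hk hN4 U₀ c hδ₀0 (hUbox c hc) b hb1 c' hc'
    refine (hγ c u ω hω0 hosc).trans (le_of_eq ?_)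
    rw [hκdef, hLk, hPL]; ring
  -- the plaquette data
  have hU₀P : ∀ q ∈ plaqsIn 0 Ω,
      ‖((GaugeField.gaugeAct (g q) U₀ ⟨q.src, q.μ⟩ : Matrix.specialUnitaryGroup n ℂ) : Matrix n n ℂ) - 1‖ ≤ ηp ∧
      ‖((GaugeField.gaugeAct (g q) U₀ ⟨q.src.shift q.μ, q.ν⟩ : Matrix.specialUnitaryGroup n ℂ) : Matrix n n ℂ) - 1‖ ≤ ηp ∧
      ‖((GaugeField.gaugeAct (g q) U₀ ⟨q.src.shift q.ν, q.μ⟩ : Matrix.specialUnitaryGroup n ℂ) : Matrix n n ℂ) - 1‖ ≤ ηp ∧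
      ‖((GaugeField.gaugeAct (g q) U₀ ⟨q.src, q.ν⟩ : Matrix.specialUnitaryGroup n ℂ) : Matrix n n ℂ) - 1‖ ≤ ηp := fun q hq =>
    ⟨hflatP q hq _ (Or.inl rfl) _ (Or.inl rfl), hflatP q hq _ (Or.inl rfl) _ (Or.inr (Or.inl rfl)), hflatP q hq _ (Or.inl rfl) _ (Or.inr (Or.inr (Or.inl rfl))),
      hflatP q hq _ (Or.inl rfl) _ (Or.inr (Or.inr (Or.inr rfl)))⟩
  have hRcurl : ∀ u : PBond (F.P K) k → Matrix n n ℂ, (∀ c, u c ∈ lieSU n) → (∀ c, c ∉ bondsIn k Ω → u c = 0) → ∀ q ∈ plaqsIn 0 Ω,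
      ‖curlM (fun b : PBond (F.P K) 0 => ((g q b.src : Matrix.specialUnitaryGroup n ℂ) : Matrix n n ℂ) * R₀ u b * star (g q b.src : Matrix n n ℂ)) q.src q.μ q.ν‖ ≤
        (Ccurl / (((F.P K).L : ℝ) ^ k) ^ 2) * ‖u‖ := by
    intro u _ _ q hq
    have h0 := hU₀P q hq
    have h := hδ U₀ q.src q.μ q.ν (ne_of_lt q.hμν) ⟨iterBlockOf k q.src, q.μ⟩ u ηp ηp hηp0 hηp0 ⟨h0.1, h0.2.2.2⟩ (fun c' hc' => by
      rw [coarsen_eq_iterBlockOf, coarsen_eq_iterBlockOf, coarsen_eq_iterBlockOf] at hc'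
      exact ⟨hflatP q hq c'.src hc' _ (Or.inl rfl), hflatP q hq c'.src hc' _ (Or.inr (Or.inr (Or.inr rfl)))⟩)
    refine h.trans (le_of_eq ?_)
    rw [hCcurldef, hLk, hPL]
    field_simp
    ring
  -- (H)
  obtain ⟨U, u, a, -, -, -, -, -, -, -, hUavg, hUplaq⟩ :=
    exists_exact_lift_regional_window_kfree (n := n) (t := t) (x := x) (η₀ := η₀) (CR := 1056) (κ := κ) (ηp := ηp) (δ₀ := δ₀) (Ccurl := Ccurl)
      (ε := ε') (B₀ := 83559424) (A₀ := 1671188480) (A₁ := 292457984)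
      hk (bondsIn k Ω) σ N (fun c _ z hz => hz) U₀ V R₀ ht0 ht4 hx0 hη₀0 (by norm_num) hκ0 hU₀ hD hRS hRn hRinv K1 K2 K3 K4 K5 K6 K7
      (↑(plaqsIn 0 Ω) : Set (Plaq (F.P K) 0)) g hCcurl0 (fun q hq => hU₀P q hq) (fun q hq => hP q hq) (fun u hu hu' q hq => hRcurl u hu hu' q hq)
      hε.le hε1 (by norm_num) (by norm_num) hδ₀A hη₀A hηpA
  refine ⟨U, hUavg, fun q hq => (hUplaq q hq).trans ?_⟩
  have hq0 : 0 ≤ ε' / Lk ^ 2 := by positivity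
  exact mul_le_mul_of_nonneg_right hBtot.le hq0

open Classical in
/-- **★★ THE `hLift` CLAUSE FOR `16 ≤ L^k` AT THE START OF RECORD (M22, v2)**: `k ≤ K`, `16 ≤ L^k`, `4L^k ≤ sitesPerDir 0`, `|n| = 2`, `0 < ε′ ≤ 1∕(10³⁴·L)`, `dist1 V(∂Q) ≤ ε′` on
`plaqsIn k Ω_{k+1}(h)`; DISPLAYED: the START lattice rows `hbox hsep hcov hbox_sh hsep_sh hcov_sh` of `startT3_cert` at `Ω_{k+1}(h)`.  THEN some finest `U` has exact `k`-fold `expMeanLogSU`-block averages `V` on `bondsIn k Ω_{k+1}(h)` and `dist1 U(∂q) ≤ 10²⁷·(ε′∕(L^k)²)` on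
`plaqsIn 0 Ω_{k+1}(h)` — `hLift_clause_of_PD` at `U₀ := startT3 F K k Ω V (tubeBd ε′)`, `δ₀ := startBd F K k ε′`, (P)∧(D) by LEAD's ★★★`startT3_cert` (its `htwo` by `htwo_of_sat (omega_sat)`, its (S6) rows by `window_S6rows`); v3 consumes `startT3_cert_omega` and displays nothing. [cite: Balaban1985Variational, Thm 1 (8) p.279, (11)–(15) pp.279–280; Balaban1985Averaging, Props. 4–5 pp.38–42] -/
theorem hLift_clause_of_start (hn2 : Fintype.card n = 2) {k : ℕ} (hkK : k ≤ K) (hm : 16 ≤ (F.P K).L ^ k) (hN4 : 4 * (F.P K).L ^ k ≤ (F.P K).sitesPerDir 0)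
    (h : Hist (F.P K) (k + 1)) (V : GaugeField (F.P K) k (Matrix.specialUnitaryGroup n ℂ)) {ε' : ℝ} (hε : 0 < ε') (hεFL : ε' ≤ 1 / (10 ^ 34 * (F.L : ℝ)))
    (hV : ∀ Q, Q ∈ plaqsIn k (Omega M₁ Rcol (k + 1) h (k + 1)) → GaugeGroup.dist1 (GaugeField.plaqHol V Q) ≤ ε')
    -- the START lattice rows of `startT3_cert` at `Ω := Ω_{k+1}(h)` (v2: `startT3_cert_omega` + `hsep_canon`∕`hsep_shell`)
    (hbox : ∀ Q, IsTubeΩ k (Omega M₁ Rcol (k + 1) h (k + 1)) Q → ∀ q : Plaq (F.P K) 0, q ∈ plaqsIn 0 (Omega M₁ Rcol (k + 1) h (k + 1)) →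
      ¬ Plaq.Deep (IsBallΩ k (Omega M₁ Rcol (k + 1) h (k + 1))) (fun v b => BallBond v (RbT (F.P K) k) b) q →
      (∃ b, Plaq.HasBond q b ∧ TubeActive V (RtT (F.P K) k) (FpOf k V) (tfOf k (Omega M₁ Rcol (k + 1) h (k + 1))) (IsTubeΩ k (Omega M₁ Rcol (k + 1) h (k + 1))) Q b) →
      ∃ u : Fin (F.P K).d → ℤ, q.src = boxSite (cornerSite k Q.src Q.μ Q.ν) u ∧ InTube Q.μ Q.ν (RtT (F.P K) k) ((F.P K).L ^ k / 2) u ∧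
        InTube Q.μ Q.ν (RtT (F.P K) k) ((F.P K).L ^ k / 2) (u + e q.μ) ∧ InTube Q.μ Q.ν (RtT (F.P K) k) ((F.P K).L ^ k / 2) (u + e q.ν) ∧
        InTube Q.μ Q.ν (RtT (F.P K) k) ((F.P K).L ^ k / 2) (u + e q.μ + e q.ν))
    (hsep : ∀ Q Q' (q : Plaq (F.P K) 0), q ∈ plaqsIn 0 (Omega M₁ Rcol (k + 1) h (k + 1)) →
      ¬ Plaq.Deep (IsBallΩ k (Omega M₁ Rcol (k + 1) h (k + 1))) (fun v b => BallBond v (RbT (F.P K) k) b) q →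
      (∃ b, Plaq.HasBond q b ∧ TubeActive V (RtT (F.P K) k) (FpOf k V) (tfOf k (Omega M₁ Rcol (k + 1) h (k + 1))) (IsTubeΩ k (Omega M₁ Rcol (k + 1) h (k + 1))) Q b) →
      (∃ b, Plaq.HasBond q b ∧ TubeActive V (RtT (F.P K) k) (FpOf k V) (tfOf k (Omega M₁ Rcol (k + 1) h (k + 1))) (IsTubeΩ k (Omega M₁ Rcol (k + 1) h (k + 1))) Q' b) → Q = Q')
    (hcov : ∀ q : Plaq (F.P K) 0, q ∈ plaqsIn 0 (Omega M₁ Rcol (k + 1) h (k + 1)) →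
      ¬ Plaq.Deep (IsBallΩ k (Omega M₁ Rcol (k + 1) h (k + 1))) (fun v b => BallBond v (RbT (F.P K) k) b) q → GaugeField.plaqHol (iterSec k V) q ≠ 1 →
      ∃ Q b, Plaq.HasBond q b ∧ TubeActive V (RtT (F.P K) k) (FpOf k V) (tfOf k (Omega M₁ Rcol (k + 1) h (k + 1))) (IsTubeΩ k (Omega M₁ Rcol (k + 1) h (k + 1))) Q b)
    (hbox_sh : ∀ Q, IsTubeΩ k (Omega M₁ Rcol (k + 1) h (k + 1)) Q → ∀ q : Plaq (F.P K) 0, ShellPlaq k (Omega M₁ Rcol (k + 1) h (k + 1)) q →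
      (∃ b, Plaq.HasBond q b ∧ TubeActive V (RtT (F.P K) k) (FpOf k V) (tfOf k (Omega M₁ Rcol (k + 1) h (k + 1))) (IsTubeΩ k (Omega M₁ Rcol (k + 1) h (k + 1))) Q b) →
      ∃ u : Fin (F.P K).d → ℤ, q.src = boxSite (cornerSite k Q.src Q.μ Q.ν) u ∧ InTube Q.μ Q.ν (RtT (F.P K) k) ((F.P K).L ^ k / 2) u ∧
        InTube Q.μ Q.ν (RtT (F.P K) k) ((F.P K).L ^ k / 2) (u + e q.μ) ∧ InTube Q.μ Q.ν (RtT (F.P K) k) ((F.P K).L ^ k / 2) (u + e q.ν) ∧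
        InTube Q.μ Q.ν (RtT (F.P K) k) ((F.P K).L ^ k / 2) (u + e q.μ + e q.ν))
    (hsep_sh : ∀ Q Q' (q : Plaq (F.P K) 0), ShellPlaq k (Omega M₁ Rcol (k + 1) h (k + 1)) q →
      (∃ b, Plaq.HasBond q b ∧ TubeActive V (RtT (F.P K) k) (FpOf k V) (tfOf k (Omega M₁ Rcol (k + 1) h (k + 1))) (IsTubeΩ k (Omega M₁ Rcol (k + 1) h (k + 1))) Q b) →
      (∃ b, Plaq.HasBond q b ∧ TubeActive V (RtT (F.P K) k) (FpOf k V) (tfOf k (Omega M₁ Rcol (k + 1) h (k + 1))) (IsTubeΩ k (Omega M₁ Rcol (k + 1) h (k + 1))) Q' b) → Q = Q')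
    (hcov_sh : ∀ q : Plaq (F.P K) 0, ShellPlaq k (Omega M₁ Rcol (k + 1) h (k + 1)) q → GaugeField.plaqHol (iterSec k V) q ≠ 1 →
      ∃ Q b, Plaq.HasBond q b ∧ TubeActive V (RtT (F.P K) k) (FpOf k V) (tfOf k (Omega M₁ Rcol (k + 1) h (k + 1))) (IsTubeΩ k (Omega M₁ Rcol (k + 1) h (k + 1))) Q b) :
    ∃ U : GaugeField (F.P K) 0 (Matrix.specialUnitaryGroup n ℂ),
      (∀ b : PBond (F.P K) k, b ∈ bondsIn k (Omega M₁ Rcol (k + 1) h (k + 1)) →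
        Averaging.iter (fun i => (blockAvg (expMeanLogSU (n := n)) : Averaging (F.P K) i (Matrix.specialUnitaryGroup n ℂ))) k U b = V b) ∧
      ∀ q : Plaq (F.P K) 0, q ∈ plaqsIn 0 (Omega M₁ Rcol (k + 1) h (k + 1)) →
        GaugeGroup.dist1 (GaugeField.plaqHol U q) ≤ 10 ^ 27 * (ε' / (((F.P K).L : ℝ) ^ k) ^ 2) := by
  have hPL : (F.P K).L = F.L := rfl
  have hL3 : 3 ≤ (F.P K).L := three_le_PL F K
  have hd3 : (F.P K).d = 3 := T3Family.P_d F K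
  have hk : k ≤ (F.P K).m + (F.P K).K := le_trans hkK (Nat.le_add_left _ _)
  have hεFL' : ε' ≤ 1 / (10 ^ 34 * ((F.P K).L : ℝ)) := by rw [hPL]; exact hεFL
  obtain ⟨hε5, hε4, -, -, -⟩ := window_eps (F.P K) hL3 hε hεFL'
  have hδ₀0 : 0 ≤ startBd F K k ε' := startBd_nonneg F K k hε.le
  have hδ₀B : startBd F K k ε' ≤ 83559424 * ε' / (((F.P K).L ^ k : ℕ) : ℝ) ^ 2 := startBd_le F K k hm hε.le hε4
  obtain ⟨hmS6, h32, hNδ⟩ := window_S6rows (F.P K) k hd3 hL3 hn2 hε hεFL' hδ₀0 hδ₀B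
  have htwo := htwo_of_sat hk (omega_sat M₁ Rcol hk h)
  obtain ⟨hP, hD⟩ := startT3_cert F K k (Omega M₁ Rcol (k + 1) h (k + 1)) V hk hm hN4 hn2 hε.le hε5 hV hbox hsep hcov hbox_sh hsep_sh hcov_sh htwo hmS6 h32 hNδ
  exact hLift_clause_of_PD F K M₁ Rcol hn2 hkK hm hN4 h V hε hεFL _ hδ₀0 hδ₀B hP hD

end Summit.QuantumFields.YangMills.Theorems.TubeStart

end
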